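import Mathlib
import Summits.Ventures.HodgeRepro.Tier4.Common.TargetDataV3
import Summits.Ventures.HodgeRepro.Tier4.Line2.N2Diag
import Summits.Ventures.HodgeRepro.Tier4.Line2.IsogenyPushforwardCor

/-!
# Tier4/Line2/N2Transfer — N2 transfers along the diagonal pushforward of the re-chosen lifts (PREPARED, HOME-only;
t4-L2-p2 g3, plan-2 g2's v3-side item S13409; NOT proposable before a FROZEN v3 target + countersign + plan-2's word)

Blind re-derivation cell `pub-hodge-repro`, Tier 4 (README §9–§10), LINE L2.  Typed against the HOME drafts
`Tier4/TargetV3.lean` (5cbd6eb48780e2c3 · 328) and `Tier4/Common/TargetDataV3.lean` (e4b5573423c6e837 · 134) by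
concatenation; imports (when those land) `Tier4.Common.TargetDataV3` + `Tier4.Line2.N2Diag` (p678951, the
target-free atom `n2_body_diag`) + `Tier4.Line2.IsogenyPushforwardCor` (p678577).  Shape adjudicated by t4-plan-2 g2
(S13423 (b)): the proof is `n2_body_diag` applied to each central-modulo-`N` element `γ`.

THE RUNG.  `TargetData.N2` (TargetDataV3 L56) asks, for every deep level `N` and every rational `γ` central modulo `N`,
eigen-relations up to additive constants of the four used coordinate functions `comp (T i) s hs (a i)` with
`χ₁χ₂ = χ₃χ₄`.  Replacing the lifts `a' i` by the diagonally pushed-forward lifts `σ ↦ c i σ · a' i z σ`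
(IsogenyPushforward p676075 / IsogenyPushforwardCor p678577) multiplies each used coordinate function by the non-zero
scalar `c i ⟨s, hs⟩` (`comp_diag`, a definitional equality), so each eigen-relation survives with the SAME eigenvalue
`χ_i` and the constant `c i ⟨s, hs⟩ · c₀`: N2 on the re-levelled datum with lifts `a'` gives N2 on the re-levelled datum
with lifts `c · a'` (`N2_relevel_diag` = `n2_body_diag` at every `γ`), for ANY certificate `ha''` that the scaled lifts are
Albanese lifts (the statement does not depend on it).  The CM case `c i σ := σ x` for an algebraic integer `x ≠ 0` of `F` — the form in
which L2-v3's ν-twisted corner lifts land into the GIVEN lattices (`isAlbaneseLift_cm_mul`) — is `N2_relevel_cm_mul`.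
Together with `pairing_cm_mul_ne_zero_iff` (the (P)-integral transfers) this says: in `P_T4v3`'s `∃ a'`, the re-choice
`a' ↦ x · a'` changes neither the N2 conjunct nor the non-vanishing of any target integral.  No printed input.

Nothing here asserts anything about the Hodge conjecture for CM abelian varieties, which is NOT proved (HC_CM is NOT
proved by anyone in this repository).
-/

set_option autoImplicit false

noncomputable section

namespace Summit.Ventures.HodgeRepro.Tier4

open Matrix MeasureTheory NumberField
open scoped ComplexConjugate

namespace TargetData

variable {F E : Type} [Field F] [NumberField F] [IsGalois ℚ F] [IsCMField F]
  [Field E] [NumberField E] [IsGalois ℚ E] [IsCMField E] (d : TargetData F E)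

/-- **N2 transfers along the diagonal pushforward of the lifts**: if the datum re-levelled to `Γ'` with lifts `a'`
satisfies N2, so does the datum re-levelled to `Γ'` with the pushed-forward lifts `σ ↦ c i σ · a' i z σ` (for any
certificate `ha''` that these are Albanese lifts) — the eigenvalues `χ₁ … χ₄` are unchanged, the constants scale. -/
theorem N2_relevel_diag (Γ' : Set (Matrix (Fin 3) (Fin 3) E))
    (hΓ' : IsCongruenceSubgroup (IsCMField.complexConj E).toRingEquiv d.H Γ')
    (a' : ∀ i : Fin 4, (Fin 2 → ℂ) → (↥(d.T i) → ℂ)) (ha' : ∀ i, IsAlbaneseLift (d.T i) (d.Λ i) d.τ₀ d.C Γ' (a' i))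
    (c : ∀ i : Fin 4, ↥(d.T i) → ℂ)
    (ha'' : ∀ i, IsAlbaneseLift (d.T i) (d.Λ i) d.τ₀ d.C Γ' (fun z σ => c i σ * a' i z σ)) :
    (d.relevel Γ' hΓ' a' ha').N2 → (d.relevel Γ' hΓ' (fun i z σ => c i σ * a' i z σ) ha'').N2 := by
  intro hN2 N hN hsub γ hγ
  exact n2_body_diag d.τ₀ d.C γ d.T d.s d.i₁ d.i₂ d.i₃ d.i₄ d.hs₁ d.hs₂ d.hs₃ d.hs₄ c a' (hN2 N hN hsub γ hγ)

/-- **The CM case**: multiplying the re-chosen lifts by an algebraic integer `x ≠ 0` of `F` (the CM isogeny `x·`,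
which keeps them Albanese lifts into the GIVEN lattices by `isAlbaneseLift_cm_mul`) preserves N2. -/
theorem N2_relevel_cm_mul (Γ' : Set (Matrix (Fin 3) (Fin 3) E))
    (hΓ' : IsCongruenceSubgroup (IsCMField.complexConj E).toRingEquiv d.H Γ')
    (a' : ∀ i : Fin 4, (Fin 2 → ℂ) → (↥(d.T i) → ℂ)) (ha' : ∀ i, IsAlbaneseLift (d.T i) (d.Λ i) d.τ₀ d.C Γ' (a' i))
    (x : F) (hx : IsIntegral ℤ x) (hx0 : x ≠ 0) :
    (d.relevel Γ' hΓ' a' ha').N2 →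
      (d.relevel Γ' hΓ' (fun i z σ => σ.1 x * a' i z σ)
        (fun i => isAlbaneseLift_cm_mul (d.T i) (d.Λ i) (d.hΛ i) d.τ₀ d.C Γ' (a' i) x hx hx0 (ha' i))).N2 :=
  d.N2_relevel_diag Γ' hΓ' a' ha' (fun _ σ => σ.1 x) _

end TargetData

end Summit.Ventures.HodgeRepro.Tier4

end
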